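import Mathlib.RingTheory.Ideal.Int
import Literature.NumberTheory.EllipticCurves.CanonicalPAdicHeightAdmissibleProofs
import HarnessLib

/-!
# The canonical `p`-adic height over `K` restricts to `[K:ℚ]` times the one over `ℚ`
# (discharge of `WeierstrassCurve.isCanonicalK_restrictsTo`)

Trunk T-NT-EC (Literature/NumberTheory/EllipticCurves); proofs only, sibling of
`CanonicalPAdicHeight.lean`. DISCHARGES the named fact `WeierstrassCurve.isCanonicalK_restrictsTo`
stated there (unchanged): for `E/ℚ` with globally minimal `W`, a number field `K` with `W ⊗ K`
globally minimal and a prime `p ≥ 5` of good ordinary reduction, a canonical `K`-datum `DK`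
(`PAdicHeightDataK.IsCanonical`: `p` totally split in `K` and `⟨P, P⟩ = ĥ_{p,K}(P)` on
`K`-admissible points) and a canonical `ℚ`-datum `D` (`⟨P, P⟩ = ĥ_p(P)` on admissible points)
satisfy `DK.RestrictsTo D`, i.e. `⟨ιP, ιQ⟩_K = [K:ℚ] · ⟨P, Q⟩` on `E(ℚ)` (`ι : E(ℚ) → E(K)` the
tree's `pointToBaseChange`; the un-normalised convention of `PAdicHeightsK.lean`).

## The argument

The cyclotomic height over `K` is `ρ^K_cycl = ρ^ℚ_cycl ∘ N_{K/ℚ}` applied to the idelic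
height, a SUM OVER THE PLACES of `K` (Mazur–Stein–Tate 2006, §2.8, eq. for `h_p` over `K`;
Balakrishnan–Çiperiani–Stein 2015, §4.1 eq. (4.1), the formula vendored as
`canonicalPAdicHeightK`), so a rational point acquires the factor `[K:ℚ]`. Formally:

* `E(ℚ) → E(K)` is an injective group homomorphism (the tree's `pointToBaseChange` agrees with
  Mathlib's `Affine.Point.map`, `pointToBaseChange_eq_map`), so both
  `(P, Q) ↦ ⟨ιP, ιQ⟩_K` and `(P, Q) ↦ [K:ℚ]⟨P, Q⟩` are symmetric bilinear torsion-vanishing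
  pairings on `E(ℚ)`;
* an admissible `P ∈ E(ℚ)` is `K`-admissible (`isAdmissibleK_pointToBaseChange`): every
  `ι : K → ℚ_p` sees the same `p`-adic point, and non-singular reduction modulo the rational prime
  `ℓ` under a finite place `v` (there is one: `ℓ = N(𝔭_v ∩ ℤ) ∈ 𝔭_v`) gives non-singular
  reduction at `v`, because `ord_ℓ x < 0 ⇒ |x|_v > 1` and an `ℓ`-adic unit is a `v`-adic unit
  (`one_lt_valuation_ratCast_of_padicValRat_neg`,
  `valuation_ratCast_eq_one_of_padicValRat_eq_zero`);
* on such `P = (x, y)`: `𝔡_K(x) = (den x)` (Bézout), `N(𝔡_K(x)) = (den x)^{[K:ℚ]}`,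
  `log_p (dⁿ) = n log_p d` (the tree's theorem `padicLog_mul_holds`) and the sum over the
  `[K:ℚ]` embeddings is `[K:ℚ] log_p σ_p(z(P))`, whence `ĥ_{p,K}(ιP) = [K:ℚ] ĥ_p(P)`
  (`canonicalPAdicHeightK_pointToBaseChange`);
* every non-torsion point of `E(ℚ)` has an admissible multiple — the tree's THEOREM
  `exists_admissible_nsmul_holds` (`CanonicalPAdicHeightAdmissibleProofs.lean`) — so the two
  pairings, agreeing on `⟨Q, Q⟩` for admissible `Q`, are equal (`pairing_eq_of_sq_eq_on`:
  scale by `m²`, polarise).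

Nothing is asserted; the trust base of `isCanonicalK_restrictsTo_holds` is empty (all inputs are
theorems of the tree and Mathlib).

## Sources

* J. S. Balakrishnan, M. Çiperiani, W. Stein, *p-adic heights of Heegner points and `Λ`-adic
  regulators*, Math. Comp. 84 (2015), §4.1 eq. (4.1) and conditions (1), (2) (the number-field
  sigma formula; paywalled, not re-read here — the statement used is the tree's transcription
  `canonicalPAdicHeightK`). [BalakrishnanCiperianiStein2015]
* B. Mazur, W. Stein, J. Tate, *Computation of `p`-adic heights and log convergence*, Doc. Math.
  Extra Vol. Coates (2006), §2.8 (PDF p. 11 of the held copy: `ρ^K_cycl = ρ^ℚ_cycl ∘ N_{K/ℚ}`,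
  `h_p(P) = p⁻¹(Σ_{v|p} log_p N_{K_v/ℚ_p} σ_v(P) - Σ_{w∤p} ord_w(d_w(P)) log_p #k_w)`).
* B. Perrin-Riou, Invent. Math. 89 (1987), §1.2 (the convention of `RestrictsTo`).

## Design notes

* The hypotheses `5 ≤ p`, good ordinary reduction and `W ⊗ K` globally minimal of the fact are
  not used by the proof (admissible multiples exist for every prime and every `ℤ`-integral
  equation); they are kept because the statement is discharged unchanged.
* `pointToBaseChange_eq_map` types Mathlib's `Affine.Point.map (Algebra.ofId ℚ K)` on
  `W.toAffine.Point`, using that `W.baseChange ℚ = W` definitionally; additivity and injectivity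
  of `pointToBaseChange` are then Mathlib's. No definition is introduced (proofs only).
* Curve statements are deliberate dot-notation extensions of Mathlib's `WeierstrassCurve`
  namespace (as the fact and the sibling proof files); generic lemmas (places of `K` over a
  rational prime, `ℓ`-adic versus `v`-adic valuations of rationals, `padicLog_pow`) are in
  `Literature.NumberTheory.EllipticCurves`.
-/

noncomputable section

open scoped Classical
open IsDedekindDomain NumberField

namespace Literature.NumberTheory.EllipticCurves

/-! ### Rational numbers at the finite places of a number field -/

section Places

variable {K : Type*} [Field K] [NumberField K] (v : HeightOneSpectrum (𝓞 K))

omit [NumberField K] in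
/-- Every finite place `v` of a number field lies over a rational prime: there is a prime number
`ℓ` with `ℓ ∈ 𝔭_v`, namely `ℓ = N(𝔭_v ∩ ℤ)` (Mathlib `Nat.absNorm_under_prime`,
`Int.absNorm_under_mem`). [folklore] -/
theorem exists_prime_natCast_mem_asIdeal : ∃ ℓ : ℕ, ℓ.Prime ∧ (ℓ : 𝓞 K) ∈ v.asIdeal := by
  haveI : v.asIdeal.IsPrime := v.isPrime
  haveI : NeZero v.asIdeal := ⟨by rw [Ideal.zero_eq_bot]; exact v.ne_bot⟩
  exact ⟨_, Nat.absNorm_under_prime v.asIdeal, Int.absNorm_under_mem v.asIdeal⟩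

variable {v}

/-- An integer prime to a rational prime `ℓ ∈ 𝔭_v` is a `v`-adic unit. [folklore] -/
theorem valuation_intCast_eq_one_of_not_dvd {ℓ : ℕ} (hℓ : ℓ.Prime) (hℓv : (ℓ : 𝓞 K) ∈ v.asIdeal)
    {n : ℤ} (hn : ¬ (ℓ : ℤ) ∣ n) : v.valuation K (n : K) = 1 := by
  have e : (n : K) = algebraMap (𝓞 K) K (n : 𝓞 K) := by simp
  rw [e, HeightOneSpectrum.valuation_eq_one_iff_notMem]
  intro hmem
  obtain ⟨a, b, hab⟩ := (Nat.prime_iff_prime_int.mp hℓ).coprime_iff_not_dvd.mpr hn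
  have h1 : (1 : 𝓞 K) ∈ v.asIdeal := by
    have : (a : 𝓞 K) * (ℓ : 𝓞 K) + (b : 𝓞 K) * (n : 𝓞 K) = 1 := by exact_mod_cast hab
    rw [← this]
    exact v.asIdeal.add_mem (v.asIdeal.mul_mem_left _ hℓv) (v.asIdeal.mul_mem_left _ hmem)
  exact v.isPrime.ne_top ((Ideal.eq_top_iff_one _).mpr h1)

/-- A natural number divisible by a rational prime `ℓ ∈ 𝔭_v` has `v`-adic absolute value `< 1`.
[folklore] -/
theorem valuation_natCast_lt_one_of_dvd {ℓ : ℕ} (hℓv : (ℓ : 𝓞 K) ∈ v.asIdeal) {n : ℕ}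
    (hn : ℓ ∣ n) : v.valuation K (n : K) < 1 := by
  obtain ⟨k, rfl⟩ := hn
  have e : ((ℓ * k : ℕ) : K) = algebraMap (𝓞 K) K ((ℓ : 𝓞 K) * (k : 𝓞 K)) := by simp
  rw [e]
  exact (HeightOneSpectrum.valuation_lt_one_iff_mem v _).mpr (v.asIdeal.mul_mem_right _ hℓv)

/-- For a non-zero rational `q` and a prime `ℓ`: `ord_ℓ q = 0` iff `ℓ` divides neither the
numerator nor the denominator, and `ord_ℓ q < 0` implies `ℓ ∣ den q`, `ℓ ∤ num q`. [folklore] -/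
theorem not_dvd_num_of_dvd_den {ℓ : ℕ} (hℓ : ℓ.Prime) {q : ℚ} (hd : ℓ ∣ q.den) :
    ¬ (ℓ : ℤ) ∣ q.num := by
  intro hn
  have := Nat.dvd_gcd (Int.natCast_dvd.mp hn) hd
  rw [q.reduced.gcd_eq_one, Nat.dvd_one] at this
  exact hℓ.one_lt.ne' this

/-- `ord_ℓ q < 0` implies `ℓ ∣ den q`. [folklore] -/
theorem dvd_den_of_padicValRat_neg {ℓ : ℕ} {q : ℚ} (hq : padicValRat ℓ q < 0) : ℓ ∣ q.den := by
  by_contra hd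
  have : padicValNat ℓ q.den = 0 := padicValNat.eq_zero_of_not_dvd hd
  simp only [padicValRat, this, CharP.cast_eq_zero, sub_zero] at hq
  exact (Int.natCast_nonneg _).not_gt hq

/-- `q ≠ 0`, `ord_ℓ q = 0` implies `ℓ ∤ num q` and `ℓ ∤ den q`. [folklore] -/
theorem not_dvd_of_padicValRat_eq_zero {ℓ : ℕ} (hℓ : ℓ.Prime) {q : ℚ} (hq0 : q ≠ 0)
    (hq : padicValRat ℓ q = 0) : ¬ (ℓ : ℤ) ∣ q.num ∧ ¬ ℓ ∣ q.den := by
  haveI := Fact.mk hℓ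
  by_cases hd : ℓ ∣ q.den
  · exfalso
    have hnum : padicValInt ℓ q.num = 0 := by
      rw [padicValInt, padicValNat.eq_zero_of_not_dvd]
      exact fun h => not_dvd_num_of_dvd_den hℓ hd (Int.natCast_dvd.mpr h)
    have h1 : 1 ≤ padicValNat ℓ q.den := one_le_padicValNat_of_dvd q.den_nz hd
    simp only [padicValRat, hnum, CharP.cast_eq_zero, zero_sub, neg_eq_zero,
      Nat.cast_eq_zero] at hq
    omega
  · refine ⟨fun hn => ?_, hd⟩
    have hden : padicValNat ℓ q.den = 0 := padicValNat.eq_zero_of_not_dvd hd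
    have hnum : padicValInt ℓ q.num = 0 := by
      have := hq; simp only [padicValRat, hden, CharP.cast_eq_zero, sub_zero,
        Nat.cast_eq_zero] at this; exact this
    rw [padicValInt, padicValNat.eq_zero_iff] at hnum
    rcases hnum with h | h | h
    · exact hℓ.one_lt.ne' h
    · exact (Int.natAbs_eq_zero.not.mpr (Rat.num_ne_zero.mpr hq0)) h
    · exact h (Int.natCast_dvd.mp hn)

/-- **A rational `ℓ`-adic unit is a `v`-adic unit at every place `v` above `ℓ`.** [folklore] -/
theorem valuation_ratCast_eq_one_of_padicValRat_eq_zero {ℓ : ℕ} (hℓ : ℓ.Prime)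
    (hℓv : (ℓ : 𝓞 K) ∈ v.asIdeal) {q : ℚ} (hq0 : q ≠ 0) (hq : padicValRat ℓ q = 0) :
    v.valuation K (q : K) = 1 := by
  obtain ⟨hnum, hden⟩ := not_dvd_of_padicValRat_eq_zero hℓ hq0 hq
  have hden' : ¬ (ℓ : ℤ) ∣ (q.den : ℤ) := fun h => hden (Int.natCast_dvd_natCast.mp h)
  rw [Rat.cast_def, map_div₀, valuation_intCast_eq_one_of_not_dvd hℓ hℓv hnum,
    ← Int.cast_natCast, valuation_intCast_eq_one_of_not_dvd hℓ hℓv hden', div_one]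

/-- **A rational with `ord_ℓ q < 0` has `|q|_v > 1` at every place `v` above `ℓ`.** [folklore] -/
theorem one_lt_valuation_ratCast_of_padicValRat_neg {ℓ : ℕ} (hℓ : ℓ.Prime)
    (hℓv : (ℓ : 𝓞 K) ∈ v.asIdeal) {q : ℚ} (hq : padicValRat ℓ q < 0) :
    1 < v.valuation K (q : K) := by
  have hden := dvd_den_of_padicValRat_neg hq
  have hnum := not_dvd_num_of_dvd_den hℓ hden
  have hd0 : v.valuation K ((q.den : ℕ) : K) ≠ 0 :=
    (Valuation.ne_zero_iff _).mpr (by exact_mod_cast q.den_pos.ne')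
  rw [Rat.cast_def, map_div₀, valuation_intCast_eq_one_of_not_dvd hℓ hℓv hnum,
    one_lt_div₀ (zero_lt_iff.mpr hd0)]
  exact valuation_natCast_lt_one_of_dvd hℓv hden

end Places

end Literature.NumberTheory.EllipticCurves

namespace WeierstrassCurve

open Literature.NumberTheory.EllipticCurves

/-! ### `E(ℚ) → E(K)` is a group homomorphism -/

section BaseChange

variable (W : WeierstrassCurve ℚ) (K : Type) [Field K] [NumberField K]

/-- **`E(ℚ) → E(K)` is Mathlib's group homomorphism `Affine.Point.map`** along `ℚ →ₐ[ℚ] K`,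
read on `W.toAffine.Point` through the definitional identification `W ⊗_ℚ ℚ = W`: the tree's
plain function `pointToBaseChange` agrees with it pointwise. [Silverman AEC III.2] [folklore] -/
theorem pointToBaseChange_eq_map (P : W.toAffine.Point) :
    W.pointToBaseChange K P = Affine.Point.map (W' := W) (F := ℚ) (Algebra.ofId ℚ K) P := by
  rcases P with _ | ⟨x, y, h⟩ <;> rfl

/-- `pointToBaseChange` is additive. [Silverman AEC III.2] [folklore] -/
theorem pointToBaseChange_add (P Q : W.toAffine.Point) :
    W.pointToBaseChange K (P + Q) = W.pointToBaseChange K P + W.pointToBaseChange K Q := by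
  rw [pointToBaseChange_eq_map, pointToBaseChange_eq_map, pointToBaseChange_eq_map]
  exact map_add (Affine.Point.map (W' := W) (F := ℚ) (Algebra.ofId ℚ K)) P Q

/-- `pointToBaseChange` is injective. [folklore] -/
theorem pointToBaseChange_injective : Function.Injective (W.pointToBaseChange K) := by
  intro P Q h
  rw [pointToBaseChange_eq_map, pointToBaseChange_eq_map] at h
  exact Affine.Point.map_injective (W' := W) (F := ℚ) (Algebra.ofId ℚ K) h

/-- `pointToBaseChange` preserves (in)finite order. [folklore] -/
theorem isOfFinAddOrder_pointToBaseChange_iff (P : W.toAffine.Point) :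
    IsOfFinAddOrder (W.pointToBaseChange K P) ↔ IsOfFinAddOrder P := by
  rw [pointToBaseChange_eq_map]
  exact (Affine.Point.map_injective (W' := W) (F := ℚ) (Algebra.ofId ℚ K)).isOfFinAddOrder_iff
    (f := Affine.Point.map (W' := W) (F := ℚ) (Algebra.ofId ℚ K))

end BaseChange

/-! ### Admissible rational points are admissible over `K` -/

section Admissible

variable (W : WeierstrassCurve ℚ) (p : ℕ) [Fact p.Prime] (K : Type) [Field K] [NumberField K]

/-- The partial derivative `Φ_x` commutes with base change. [folklore] -/
theorem baseChange_polynomialX_evalEval (x y : ℚ) :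
    (W.baseChange K).toAffine.polynomialX.evalEval (algebraMap ℚ K x) (algebraMap ℚ K y) =
      algebraMap ℚ K (W.toAffine.polynomialX.evalEval x y) := by
  rw [Affine.evalEval_polynomialX, Affine.evalEval_polynomialX]
  simp only [baseChange, map_a₁, map_a₂, map_a₄, map_sub, map_add, map_mul, map_pow, map_ofNat]

/-- The partial derivative `Φ_y` commutes with base change. [folklore] -/
theorem baseChange_polynomialY_evalEval (x y : ℚ) :
    (W.baseChange K).toAffine.polynomialY.evalEval (algebraMap ℚ K x) (algebraMap ℚ K y) =
      algebraMap ℚ K (W.toAffine.polynomialY.evalEval x y) := by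
  rw [Affine.evalEval_polynomialY, Affine.evalEval_polynomialY]
  simp only [baseChange, map_a₁, map_a₃, map_add, map_mul, map_ofNat]

variable {W p} in
/-- **An admissible point of `E(ℚ)` is admissible in `E(K)`**: under every `ι : K → ℚ_p` its
coordinates are the same `p`-adic numbers (`E₁` and sigma-disc conditions), it stays non-torsion
(`E(ℚ) ↪ E(K)` is an injective homomorphism), and non-singular reduction modulo the prime `ℓ`
below a finite place `v` gives non-singular reduction at `v`, since `ord_ℓ x < 0 ⇒ |x|_v > 1` and
an `ℓ`-adic unit is a `v`-adic unit. [Balakrishnan–Çiperiani–Stein 2015, §4.1 (conditions (1),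
(2)); Silverman AEC VII.2] [folklore] -/
theorem isAdmissibleK_pointToBaseChange {P : W.toAffine.Point} (hP : W.IsAdmissible p P) :
    W.IsAdmissibleK p K (W.pointToBaseChange K P) := by
  refine ⟨fun h => hP.1 ((W.isOfFinAddOrder_pointToBaseChange_iff K P).mp h), ?_⟩
  rcases P with _ | ⟨x, y, h⟩
  · exact hP.2.elim
  · obtain ⟨hx, hz, hns⟩ := hP.2
    refine ⟨fun ι => ?_, fun v => ?_⟩
    · have ex : ι (algebraMap ℚ K x) = (x : ℚ_[p]) := by rw [eq_ratCast, map_ratCast]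
      have ey : ι (algebraMap ℚ K y) = (y : ℚ_[p]) := by rw [eq_ratCast, map_ratCast]
      rw [ex, ey]
      exact ⟨hx, hz⟩
    · obtain ⟨ℓ, hℓ, hℓv⟩ := exists_prime_natCast_mem_asIdeal v
      rcases hns ℓ hℓ with hneg | ⟨hne, h0⟩ | ⟨hne, h0⟩
      · left
        rw [eq_ratCast]
        exact one_lt_valuation_ratCast_of_padicValRat_neg hℓ hℓv hneg
      · right; left
        rw [baseChange_polynomialX_evalEval, eq_ratCast]
        exact valuation_ratCast_eq_one_of_padicValRat_eq_zero hℓ hℓv hne h0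
      · right; right
        rw [baseChange_polynomialY_evalEval, eq_ratCast]
        exact valuation_ratCast_eq_one_of_padicValRat_eq_zero hℓ hℓv hne h0

end Admissible

/-! ### The sigma formula over `K` at a rational point is `[K:ℚ]` times the one over `ℚ` -/

section HeightIdentity

variable (K : Type) [Field K] [NumberField K]

/-- **The denominator ideal of a rational number** `x = a/d` (lowest terms) in `𝓞_K` is the
principal ideal `(d)`: `r x ∈ 𝓞_K` iff `d ∣ r` (Bézout `ua + wd = 1` gives
`r = (u · (r x) + w · r) d`). [folklore] -/
theorem denominatorIdeal_algebraMap (x : ℚ) :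
    denominatorIdeal K (algebraMap ℚ K x) = Ideal.span {(x.den : 𝓞 K)} := by
  have hcop : IsCoprime x.num (x.den : ℤ) := by
    rw [Int.isCoprime_iff_gcd_eq_one]
    exact x.reduced
  obtain ⟨a, b, hab⟩ := hcop
  have hinj : Function.Injective (algebraMap (𝓞 K) K) := FaithfulSMul.algebraMap_injective _ _
  have hxK : (x.den : K) * algebraMap ℚ K x = (x.num : K) := by
    rw [eq_ratCast]; exact_mod_cast x.den_mul_eq_num
  have habK : (a : K) * (x.num : K) + (b : K) * (x.den : K) = 1 := by exact_mod_cast hab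
  ext r
  simp only [denominatorIdeal, Submodule.mem_mk, AddSubmonoid.mem_mk, AddSubsemigroup.mem_mk,
    Set.mem_setOf_eq, Ideal.mem_span_singleton']
  constructor
  · rintro ⟨s, hs⟩
    refine ⟨(a : 𝓞 K) * s + (b : 𝓞 K) * r, hinj ?_⟩
    simp only [map_mul, map_add, map_intCast, map_natCast]
    have hr : algebraMap (𝓞 K) K r = (r : K) := rfl
    have hs' : algebraMap (𝓞 K) K s = (s : K) := rfl
    rw [hr, hs']
    linear_combination (-(a : K) * (x.den : K)) * hs + ((a : K) * (r : K)) * hxK + (r : K) * habK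
  · rintro ⟨c, rfl⟩
    refine ⟨c * (x.num : 𝓞 K), ?_⟩
    have e1 : ((c * (x.den : 𝓞 K) : 𝓞 K) : K) = (c : K) * (x.den : K) := by
      show algebraMap (𝓞 K) K _ = _
      rw [map_mul, map_natCast]
    have e2 : ((c * (x.num : 𝓞 K) : 𝓞 K) : K) = (c : K) * (x.num : K) := by
      show algebraMap (𝓞 K) K _ = _
      rw [map_mul, map_intCast]
    rw [e1, e2, mul_assoc, hxK]

/-- Its norm: `N(𝔡_K(x)) = (den x)^{[K:ℚ]}` (`N((d)) = |N_{K/ℚ}(d)| = d^{[K:ℚ]}`). [folklore] -/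
theorem absNorm_denominatorIdeal_algebraMap (x : ℚ) :
    Ideal.absNorm (denominatorIdeal K (algebraMap ℚ K x)) = x.den ^ Module.finrank ℚ K := by
  rw [denominatorIdeal_algebraMap, Ideal.absNorm_span_singleton, Algebra.norm_natCast,
    Int.natAbs_pow, Int.natAbs_natCast, RingOfIntegers.rank]

/-- `log_p (aⁿ) = n log_p a` for `a ≠ 0` (multiplicativity of the Iwasawa logarithm, the tree's
theorem `padicLog_mul_holds`). [Iwasawa 1972, §4.4] [folklore] -/
theorem _root_.Literature.NumberTheory.EllipticCurves.padicLog_pow (p : ℕ) [Fact p.Prime]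
    {a : ℚ_[p]} (ha : a ≠ 0) (n : ℕ) : padicLog p (a ^ n) = n * padicLog p a := by
  induction n with
  | zero => simp [padicLog_one]
  | succ n ih =>
    rw [pow_succ, padicLog_mul_holds p (pow_ne_zero _ ha) ha, ih]
    push_cast
    ring

variable (W : WeierstrassCurve ℚ) (p : ℕ) [Fact p.Prime]

/-- **The sigma formula over `K` at a rational point.** If `p` is totally split in `K`
(`#(K → ℚ_p) = [K:ℚ]`), then for `P ∈ E(ℚ)`,
`ĥ_{p,K}(ιP) = log_p N(𝔡_K(x)) - 2 Σ_ι log_p σ_p(z(ιP)) = [K:ℚ] · ĥ_p(P)`: `N(𝔡_K(x)) =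
(den x)^{[K:ℚ]}`, `log_p` of a power, and each of the `[K:ℚ]` embeddings sees the same `p`-adic
point. [Balakrishnan–Çiperiani–Stein 2015, §4.1 eq. (4.1); Mazur–Stein–Tate 2006, §2.8
(`ρ^K_cycl = ρ^ℚ_cycl ∘ N_{K/ℚ}`)] [folklore] -/
theorem canonicalPAdicHeightK_pointToBaseChange
    (hcard : Fintype.card (K →+* ℚ_[p]) = Module.finrank ℚ K) (P : W.toAffine.Point) :
    W.canonicalPAdicHeightK p K (W.pointToBaseChange K P) =
      (Module.finrank ℚ K : ℚ_[p]) * W.canonicalPAdicHeight p P := by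
  rcases P with _ | ⟨x, y, h⟩
  · simp [canonicalPAdicHeightK, canonicalPAdicHeight, pointToBaseChange]
  · simp only [pointToBaseChange, canonicalPAdicHeightK, canonicalPAdicHeight]
    rw [absNorm_denominatorIdeal_algebraMap]
    simp only [eq_ratCast, map_ratCast, Finset.sum_const, Finset.card_univ, hcard, nsmul_eq_mul]
    have hd : ((x.den : ℚ) : ℚ_[p]) ≠ 0 := by exact_mod_cast x.den_nz
    have hpow : (((x.den ^ Module.finrank ℚ K : ℕ) : ℚ) : ℚ_[p]) =
        ((x.den : ℚ) : ℚ_[p]) ^ Module.finrank ℚ K := by push_cast; rfl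
    rw [hpow, padicLog_pow p hd]
    ring

end HeightIdentity

/-! ### The discharge -/

/-- **Discharge of `WeierstrassCurve.isCanonicalK_restrictsTo`** (`CanonicalPAdicHeight.lean`): for
`E/ℚ` with globally minimal `W`, a number field `K` with `W ⊗ K` globally minimal and a prime
`p ≥ 5` of good ordinary reduction, every canonical `K`-datum `DK` restricts on `E(ℚ)` to `[K:ℚ]`
times every canonical `ℚ`-datum `D`: `⟨ιP, ιQ⟩_K = [K:ℚ] ⟨P, Q⟩` for all `P, Q ∈ E(ℚ)`. Proof: both
sides are symmetric bilinear torsion-vanishing pairings on `E(ℚ)`; on an admissible `Q` they are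
`ĥ_{p,K}(ιQ)` (as `ιQ` is `K`-admissible, `isAdmissibleK_pointToBaseChange`) and `[K:ℚ] ĥ_p(Q)`,
which agree (`canonicalPAdicHeightK_pointToBaseChange`, using that `p` is totally split — the first
clause of `PAdicHeightDataK.IsCanonical`); every non-torsion point has an admissible multiple
(the tree's theorem `exists_admissible_nsmul_holds`), so the pairings coincide
(`pairing_eq_of_sq_eq_on`: scale by `m²` and polarise). The hypotheses on `p` and on `W ⊗ K` are
those of the fact and are not otherwise used. [Balakrishnan–Çiperiani–Stein 2015, §4.1;
Mazur–Stein–Tate 2006, §2.8; Perrin-Riou 1987, §1.2] [cite: BalakrishnanCiperianiStein2015, §4.1] -/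
theorem isCanonicalK_restrictsTo_holds : isCanonicalK_restrictsTo := by
  intro W _ _ K _ _ _ p _ _ _ _ DK D hDK hD
  set ι : W.toAffine.Point →+ (W.baseChange K).toAffine.Point :=
    Affine.Point.map (W' := W) (F := ℚ) (Algebra.ofId ℚ K)
  have hι : ∀ P, ι P = W.pointToBaseChange K P := fun P => by
    rcases P with _ | ⟨x, y, h⟩ <;> rfl
  set B₁ : W.toAffine.Point →+ W.toAffine.Point →+ ℚ_[p] := (DK.pairing.comp ι).compl₂ ι
  set B₂ : W.toAffine.Point →+ W.toAffine.Point →+ ℚ_[p] :=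
    D.pairing.compr₂ (AddMonoidHom.mulLeft (Module.finrank ℚ K : ℚ_[p]))
  have h₁ : ∀ P Q, B₁ P Q = DK.pairing (W.pointToBaseChange K P) (W.pointToBaseChange K Q) :=
    fun P Q => by rw [← hι, ← hι]; rfl
  have h₂ : ∀ P Q, B₂ P Q = (Module.finrank ℚ K : ℚ_[p]) * D.pairing P Q := fun P Q => rfl
  have key : B₁ = B₂ := by
    refine pairing_eq_of_sq_eq_on B₁ B₂ (fun P Q => ?_) (fun P Q => ?_) (fun P Q hP => ?_)
      (fun P Q hP => ?_) {P | W.IsAdmissible p P} (fun P hP => ?_) (fun Q hQ => ?_)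
    · rw [h₁, h₁, DK.symm]
    · rw [h₂, h₂, D.symm]
    · rw [h₁]
      exact DK.map_torsion _ _ ((W.isOfFinAddOrder_pointToBaseChange_iff K P).mpr hP)
    · rw [h₂, D.map_torsion P Q hP, mul_zero]
    · exact exists_admissible_nsmul_holds W p P hP
    · rw [h₁, h₂, hDK.2 _ (W.isAdmissibleK_pointToBaseChange K hQ),
        W.canonicalPAdicHeightK_pointToBaseChange K p hDK.1, hD Q hQ]
  intro P Q
  rw [← h₁, ← h₂, key]

end WeierstrassCurve

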